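import Summits.ABC.ABC.Theorems.ModerateWindowCount.Negative.TwistWindow

/-!
# `ModerateWindowCount` (stmt-ABC-1973) — negative-side lemmas IV: the deterministic core of
# "`6 < σ` is sharp"

Standing-adversary (cdisprove) output. `sixSharp_core`: given the law on a window `[κ, σ]`, `3 < κ < σ ≤ 6`,
with `0 ≤ δ < (6−κ)/6`, `1 ≤ C`, an exponent `j` with `(6−κ)j > κ`, the Chebyshev threshold `T₀` and a prime
`p ≥ 3`, `p^j ≡ 1 (16)`, satisfying four largeness conditions — contradiction. With `q = p^j = 16k+1`,
`r₀ = p · rad k`, `ρ = log r₀ ∈ [log p, (j+1) log p]`, `ℓU = (6j log p − log 8 − κρ)/(2κ−6)`, `U = e^{ℓU}`,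
`ℓL = (3 log m − σρ)/(2σ−6)`: the admissible prime twists `d ∈ (max(⌈e^{ℓL}⌉,4), ⌊U⌋]`, `d ≠ p`, `d ∤ k` are
members of the window `[κ,σ]` at
`X = r₀U²` (lower ratio from `d ≤ U`, upper from `d > L`), they number `≥ U/(8ℓU) − 2j log p − 1`
(Chebyshev minus `ω(k) + 1`), while the law allows `C X^δ = C e^{δρ} U^{2δ}`; the deficit exponent
`(1−2δ)ℓU − δρ ≥ γ log p − c₀` (`γ = a(1−2δ) − (j+1)δ`) is uniform in the uncertified `ρ`, and the
largeness conditions close the inequality. Refuter seat refuter-cdisprove-stmt-ABC-1973-0, 2026-08-16.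
-/

namespace Summit.ABC.ABC.Theorems.ModerateWindowCount.Negative

open Summit.ABC.ABC.Theses.TwistAmplification WeierstrassCurve IsDedekindDomain
open Summit.ABC.ABC.Theorems.SomeWindowSaving.Negative

noncomputable section

/-! ### 4.4 The endgame, deterministic core: a large prime `p` contradicts the law on `[κ, σ]`, `σ ≤ 6` -/

set_option maxHeartbeats 1600000 in
/-- **Core of the sharpness proof.** Given the law on the window `[κ, σ]`, `3 < κ < σ ≤ 6`, with
`0 ≤ δ < (6−κ)/6`, `1 ≤ C`, an exponent `j` with `(6−κ)j > κ`, the Chebyshev threshold `T₀`, and a prime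
`p ≥ 3` with `p^j ≡ 1 (16)` satisfying the four largeness conditions (in `a = (6j−κ(j+1))/(2κ−6)`,
`b = 6(σ−κ)(j−1)/((2κ−6)(2σ−6))`, `c₀ = log 8/(2κ−6)`, `a' = 6j/(2κ−6)`, `γ = a(1−2δ) − (j+1)δ`):
contradiction. See the module docstring for the bookkeeping. [folklore] -/
theorem sixSharp_core {κ σ δ C : ℝ} (hκ3 : 3 < κ) (hκσ : κ < σ) (hσ6 : σ ≤ 6) (hδ0 : 0 ≤ δ)
    (hδ : δ < (6 - κ) / 6)
    (hC1 : 1 ≤ C) (hlaw : ∀ X : ℝ, 1 ≤ X → (windowCount κ σ X : ℝ) ≤ C * X ^ δ)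
    {j : ℕ} (hj0 : j ≠ 0) (hj4 : (4 : ℝ) ≤ j) (hnum : 0 < 6 * j - κ * ((j : ℝ) + 1))
    {T₀ : ℕ} (hT₀ : ∀ A T : ℕ, T₀ ≤ T → 6 * A + 1 ≤ T →
      (T : ℝ) / 4 ≤ (primesIoc A T).card * Real.log T)
    {p : ℕ} (hp : p.Prime) (hp3 : 3 ≤ p) (hq16 : p ^ j % 16 = 1)
    (hE1 : 2 * ((max T₀ 64 : ℕ) : ℝ) * Real.exp (Real.log 8 / (2 * κ - 6)) ≤
      (p : ℝ) ^ ((6 * j - κ * ((j : ℝ) + 1)) / (2 * κ - 6)))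
    (hE2 : 12 * Real.exp (Real.log 8 / (2 * κ - 6)) ≤
      (p : ℝ) ^ (6 * (σ - κ) * ((j : ℝ) - 1) / ((2 * κ - 6) * (2 * σ - 6))))
    (hE3 : 48 * (6 * (j : ℝ) / (2 * κ - 6)) * j * Real.exp (Real.log 8 / (2 * κ - 6)) * Real.log p ^ 2 ≤
      (p : ℝ) ^ ((6 * j - κ * ((j : ℝ) + 1)) / (2 * κ - 6)))
    (hE4 : 32 * C * (6 * (j : ℝ) / (2 * κ - 6)) * Real.exp (Real.log 8 / (2 * κ - 6)) * Real.log p ≤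
      (p : ℝ) ^ ((6 * j - κ * ((j : ℝ) + 1)) / (2 * κ - 6) * (1 - 2 * δ) - ((j : ℝ) + 1) * δ)) :
    False := by
  -- names for the exponents and constants
  set a : ℝ := (6 * j - κ * ((j : ℝ) + 1)) / (2 * κ - 6) with hadef
  set a' : ℝ := 6 * (j : ℝ) / (2 * κ - 6) with ha'def
  set b : ℝ := 6 * (σ - κ) * ((j : ℝ) - 1) / ((2 * κ - 6) * (2 * σ - 6)) with hbdef
  set c₀ : ℝ := Real.log 8 / (2 * κ - 6) with hc₀def
  set γ : ℝ := a * (1 - 2 * δ) - ((j : ℝ) + 1) * δ with hγdef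
  set T₁ : ℕ := max T₀ 64 with hT₁def
  have hC0 : 0 < C := by linarith
  have h26 : 0 < 2 * κ - 6 := by linarith
  have hκ6 : κ < 6 := lt_of_lt_of_le hκσ hσ6
  have h2σ : 0 < 2 * σ - 6 := by linarith
  have hκσ26 : 0 < (2 * κ - 6) * (2 * σ - 6) := mul_pos h26 h2σ
  have hκ0 : 0 < κ := by linarith
  have h12 : (6 - κ) / 6 < 1 / 2 := by rw [div_lt_iff₀ (by norm_num)]; linarith
  have h6δ : 0 < κ - 6 * δ := by linarith
  have h12δ : 0 < 1 - 2 * δ := by linarith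
  have ha_mul : (2 * κ - 6) * a = 6 * j - κ * (j + 1) := by rw [hadef]; field_simp
  have ha'_mul : (2 * κ - 6) * a' = 6 * j := by rw [ha'def]; field_simp
  have hb_mul : (2 * κ - 6) * (2 * σ - 6) * b = 6 * (σ - κ) * (j - 1) := by rw [hbdef]; field_simp
  have hc₀_mul : (2 * κ - 6) * c₀ = Real.log 8 := by rw [hc₀def]; field_simp
  have hlog8 : Real.log 8 = 3 * Real.log 2 := by
    rw [show (8 : ℝ) = 2 ^ 3 by norm_num, Real.log_pow]; norm_num
  have hlog2 : 0 < Real.log 2 := Real.log_pos (by norm_num)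
  have ha : 0 < a := by rw [hadef]; exact div_pos hnum h26
  have ha' : 0 < a' := by rw [ha'def]; exact div_pos (by positivity) h26
  have hγ_mul : (2 * κ - 6) * γ = (6 * j - κ * (j + 1)) * (1 - 2 * δ) - (j + 1) * δ * (2 * κ - 6) := by
    rw [hγdef, mul_sub, ← mul_assoc, ha_mul]; ring
  have hp0 : (0 : ℝ) < p := by exact_mod_cast hp.pos
  ------------------------------------------------------------------
  -- `q = p^j = 16 k + 1`
  ------------------------------------------------------------------
  set k : ℕ := p ^ j / 16 with hkdef
  have hqk : p ^ j = 16 * k + 1 := by have := Nat.div_add_mod (p ^ j) 16; omega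
  have hq : (p : ℤ) ^ j = 16 * k + 1 := by exact_mod_cast hqk
  have hk : k ≠ 0 := by
    have hqge : 3 ^ 1 ≤ p ^ j :=
      (Nat.pow_le_pow_left hp3 1).trans (Nat.pow_le_pow_right hp.pos (Nat.one_le_iff_ne_zero.mpr hj0))
    intro h; rw [h] at hqk; norm_num at hqk; omega
  have hk1 : 1 ≤ k := Nat.one_le_iff_ne_zero.mpr hk
  ------------------------------------------------------------------
  -- the real bookkeeping: `P, ρ, Lm, ℓU, U, ℓL, L`
  ------------------------------------------------------------------
  set P : ℝ := Real.log p with hPdef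
  have hP1 : 1 ≤ P := by
    have h3 : Real.log 3 ≤ Real.log p := Real.log_le_log (by norm_num) (by exact_mod_cast hp3)
    have : 1 < Real.log 3 := by
      rw [Real.lt_log_iff_exp_lt (by norm_num)]; have := Real.exp_one_lt_d9; linarith
    rw [hPdef]; linarith
  set r₀ : ℕ := p * UniqueFactorizationMonoid.radical k with hr₀def
  have hr₀p : p ≤ r₀ := Nat.le_mul_of_pos_right _ (Nat.radical_pos _)
  have hr₀0 : (0 : ℝ) < r₀ := by exact_mod_cast lt_of_lt_of_le hp.pos hr₀p
  set ρ : ℝ := Real.log r₀ with hρdef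
  have hρ1 : P ≤ ρ := Real.log_le_log hp0 (by exact_mod_cast hr₀p)
  have hρ2 : ρ ≤ (j + 1) * P := by
    have h1 : (r₀ : ℝ) ≤ (p : ℝ) ^ (j + 1) := by
      have : r₀ ≤ p ^ (j + 1) :=
        calc r₀ ≤ p * k := Nat.mul_le_mul_left _ (Nat.radical_le_self_iff.mpr hk)
          _ ≤ p * p ^ j := Nat.mul_le_mul_left _ (by omega)
          _ = p ^ (j + 1) := by ring
      exact_mod_cast this
    have h2 := Real.log_le_log hr₀0 h1
    rw [Real.log_pow] at h2; push_cast at h2; rw [hρdef, hPdef]; linarith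
  have hm0 : (0 : ℝ) < (mOf k : ℕ) := by exact_mod_cast mOf_pos k
  set Lm : ℝ := Real.log (mOf k : ℕ) with hLmdef
  have hqR : ((p : ℝ) ^ j) = 16 * k + 1 := by exact_mod_cast hqk
  have hlogq : Real.log (16 * (k : ℝ) + 1) = j * P := by rw [← hqR, Real.log_pow]
  obtain ⟨hLm1, hLm2⟩ := log_mOf_bounds k
  have hLm_hi : Lm ≤ 2 * j * P := by rw [hLmdef]; rw [hlogq] at hLm1; linarith
  have hLm_lo : 6 * j * P - Real.log 8 ≤ 3 * Lm := by rw [hLmdef, hlog8]; rw [hlogq] at hLm2; linarith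
  set ℓU : ℝ := (6 * j * P - Real.log 8 - κ * ρ) / (2 * κ - 6) with hℓUdef
  have hℓU_mul : (2 * κ - 6) * ℓU = 6 * j * P - Real.log 8 - κ * ρ := by rw [hℓUdef]; field_simp
  have hℓU_lo : a * P - c₀ ≤ ℓU := by
    have e : (2 * κ - 6) * (ℓU - (a * P - c₀)) = κ * ((j + 1) * P - ρ) := by
      have : (2 * κ - 6) * (ℓU - (a * P - c₀)) =
          (2 * κ - 6) * ℓU - ((2 * κ - 6) * a) * P + (2 * κ - 6) * c₀ := by ring
      rw [this, hℓU_mul, ha_mul, hc₀_mul]; ring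
    have h1 : 0 ≤ (2 * κ - 6) * (ℓU - (a * P - c₀)) := by rw [e]; exact mul_nonneg hκ0.le (by linarith)
    have h2 := (mul_nonneg_iff_of_pos_left h26).mp h1
    linarith
  have hℓU_hi : ℓU ≤ a' * P := by
    have e : (2 * κ - 6) * (a' * P - ℓU) = κ * ρ + Real.log 8 := by
      have : (2 * κ - 6) * (a' * P - ℓU) = ((2 * κ - 6) * a') * P - (2 * κ - 6) * ℓU := by ring
      rw [this, ha'_mul, hℓU_mul]; ring
    have hpos : 0 ≤ (2 * κ - 6) * (a' * P - ℓU) := by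
      rw [e]; have : 0 ≤ ρ := le_trans (by linarith) hρ1; positivity
    have h2 := (mul_nonneg_iff_of_pos_left h26).mp hpos
    linarith
  set U : ℝ := Real.exp ℓU with hUdef
  have hU0 : 0 < U := Real.exp_pos _
  have hlogU : Real.log U = ℓU := Real.log_exp _
  have hpa : Real.exp (a * P) = (p : ℝ) ^ a := by rw [Real.rpow_def_of_pos hp0, hPdef, mul_comm]
  have hU_lo : (p : ℝ) ^ a / Real.exp c₀ ≤ U := by
    rw [← hpa, ← Real.exp_sub, hUdef]; exact Real.exp_le_exp.mpr hℓU_lo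
  have hexpc₀ : 0 < Real.exp c₀ := Real.exp_pos _
  have hU_T₁ : 2 * (T₁ : ℝ) ≤ U := by
    refine le_trans ?_ hU_lo
    rw [le_div_iff₀ hexpc₀]; exact hE1
  have hT₁64 : (64 : ℝ) ≤ T₁ := by exact_mod_cast le_max_right T₀ 64
  have hT₁T₀ : (T₀ : ℝ) ≤ T₁ := by exact_mod_cast le_max_left T₀ 64
  have hU128 : (128 : ℝ) ≤ U := by linarith
  have hℓU0 : 0 < ℓU := by rw [← hlogU]; exact Real.log_pos (by linarith)
  have hU_E3 : 48 * a' * j * P ^ 2 ≤ U := by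
    refine le_trans ?_ hU_lo
    rw [le_div_iff₀ hexpc₀]
    have e : 48 * a' * j * P ^ 2 * Real.exp c₀ = 48 * a' * j * Real.exp c₀ * P ^ 2 := by ring
    rw [e]; exact hE3
  set ℓL : ℝ := (3 * Lm - σ * ρ) / (2 * σ - 6) with hℓLdef
  have hℓL_mul : (2 * σ - 6) * ℓL = 3 * Lm - σ * ρ := by rw [hℓLdef]; field_simp
  set L : ℝ := Real.exp ℓL with hLdef
  have hL0 : 0 < L := Real.exp_pos _
  have hUL : ℓL + Real.log 12 ≤ ℓU := by
    have E5 : (2 * κ - 6) * (2 * σ - 6) * (ℓU - ℓL) - (2 * κ - 6) * (2 * σ - 6) * (b * P - c₀) =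
        3 * (2 * κ - 6) * (2 * j * P - Lm) + 6 * (σ - κ) * ((j + 1) * P - ρ) := by
      have e1 : (2 * κ - 6) * (2 * σ - 6) * (ℓU - ℓL) - (2 * κ - 6) * (2 * σ - 6) * (b * P - c₀) =
          (2 * σ - 6) * ((2 * κ - 6) * ℓU) - (2 * κ - 6) * ((2 * σ - 6) * ℓL)
            - ((2 * κ - 6) * (2 * σ - 6) * b) * P + (2 * σ - 6) * ((2 * κ - 6) * c₀) := by ring
      rw [e1, hℓU_mul, hℓL_mul, hb_mul, hc₀_mul]; ring
    have hpos : 0 ≤ 3 * (2 * κ - 6) * (2 * j * P - Lm) + 6 * (σ - κ) * ((j + 1) * P - ρ) :=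
      add_nonneg (mul_nonneg (by linarith) (by linarith)) (mul_nonneg (by linarith) (by linarith))
    have hbP : Real.log 12 + c₀ ≤ b * P := by
      have h1 : Real.log (12 * Real.exp c₀) ≤ Real.log ((p : ℝ) ^ b) :=
        Real.log_le_log (by positivity) hE2
      rw [Real.log_mul (by norm_num) hexpc₀.ne', Real.log_exp, Real.log_rpow hp0] at h1
      rw [hPdef]; linarith
    have h3 : (2 * κ - 6) * (2 * σ - 6) * (b * P - c₀) ≤ (2 * κ - 6) * (2 * σ - 6) * (ℓU - ℓL) := by
      linarith
    have h4 : b * P - c₀ ≤ ℓU - ℓL := le_of_mul_le_mul_left h3 hκσ26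
    linarith
  have hU12L : 12 * L ≤ U := by
    have : Real.exp (ℓL + Real.log 12) ≤ Real.exp ℓU := Real.exp_le_exp.mpr hUL
    rwa [Real.exp_add, Real.exp_log (by norm_num), mul_comm] at this
  -- `V = ⌊U⌋`, `A = max ⌈L⌉ 4`
  set V : ℕ := ⌊U⌋₊ with hVdef
  have hVU : (V : ℝ) ≤ U := Nat.floor_le hU0.le
  have hUV : U < V + 1 := Nat.lt_floor_add_one U
  have hV0 : (0 : ℝ) < V := by linarith
  have hT₀V : T₀ ≤ V := Nat.le_floor (by linarith)
  set A : ℕ := max ⌈L⌉₊ 4 with hAdef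
  have hAL : ⌈L⌉₊ ≤ A := le_max_left _ _
  have hAR : (A : ℝ) ≤ L + 5 := by
    have h1 : (⌈L⌉₊ : ℝ) < L + 1 := Nat.ceil_lt_add_one hL0.le
    rw [hAdef, Nat.cast_max]
    apply max_le <;> push_cast <;> linarith
  have hAV : 6 * A + 1 ≤ V := by
    apply Nat.le_floor; push_cast; linarith [hAR, hU12L, hU128]
  ------------------------------------------------------------------
  -- the admissible twisting primes and the count
  ------------------------------------------------------------------
  set N₁ : ℝ := ((primesIoc A V).card : ℝ) with hN₁def
  have hN₁0 : 0 ≤ N₁ := Nat.cast_nonneg _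
  have hlogV : Real.log V ≤ ℓU := by rw [← hlogU]; exact Real.log_le_log hV0 hVU
  have hstar : U / 8 ≤ N₁ * ℓU := by
    have h1 : (V : ℝ) / 4 ≤ N₁ * Real.log V := hT₀ A V hT₀V hAV
    have h2 : N₁ * Real.log V ≤ N₁ * ℓU := mul_le_mul_of_nonneg_left hlogV hN₁0
    linarith
  classical
  set adm : Finset ℕ := (primesIoc A V).filter (fun d => d ≠ p ∧ ¬ d ∣ k) with hadmdef
  have hcompl : N₁ ≤ (adm.card : ℝ) + (k.primeFactors.card + 1) := by
    rw [hN₁def, hadmdef]; exact_mod_cast card_primesIoc_le_filter_add (A := A) (V := V) (p := p) hk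
  have hpf : (k.primeFactors.card : ℝ) ≤ 2 * j * P := by
    -- `ω(k) log 2 ≤ log k`: `2^{ω(k)} ≤ ∏_{q ∣ k} q ≤ k`
    have h1 : (k.primeFactors.card : ℝ) * Real.log 2 ≤ Real.log k := by
      have e1 : 2 ^ k.primeFactors.card ≤ ∏ q ∈ k.primeFactors, q :=
        Finset.pow_card_le_prod _ _ 2 (fun q hq => (Nat.prime_of_mem_primeFactors hq).two_le)
      have e2 : ∏ q ∈ k.primeFactors, q ≤ k :=
        Nat.le_of_dvd (Nat.pos_of_ne_zero hk) (Nat.prod_primeFactors_dvd k)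
      have e3 : ((2 : ℕ) : ℝ) ^ k.primeFactors.card ≤ (k : ℝ) := by exact_mod_cast e1.trans e2
      have e4 : Real.log ((2 : ℝ) ^ k.primeFactors.card) ≤ Real.log k :=
        Real.log_le_log (by positivity) (by exact_mod_cast e3)
      rwa [Real.log_pow] at e4
    have h2 : Real.log k ≤ j * P := by
      rw [← hlogq]
      exact Real.log_le_log (by exact_mod_cast hk1) (by linarith [show (0:ℝ) ≤ k from Nat.cast_nonneg k])
    have h3 := Real.log_two_gt_d9
    have h4 : (k.primeFactors.card : ℝ) * (1 / 2) ≤ k.primeFactors.card * Real.log 2 :=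
      mul_le_mul_of_nonneg_left (by linarith) (Nat.cast_nonneg _)
    linarith
  set X : ℝ := (r₀ : ℝ) * U ^ 2 with hXdef
  have hX0 : 0 < X := by positivity
  have hX1 : 1 ≤ X := by
    have h1 : (1 : ℝ) ≤ r₀ := by exact_mod_cast lt_of_lt_of_le hp.pos hr₀p
    rw [hXdef]; exact one_le_mul_of_one_le_of_one_le h1 (one_le_pow₀ (by linarith))
  have hodd : ∀ d ∈ adm, d % 2 = 1 := by
    intro d hd
    rw [hadmdef, Finset.mem_filter, primesIoc, Finset.mem_filter, Finset.mem_Ioc] at hd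
    exact Nat.odd_iff.mp (hd.1.2.odd_of_ne_two (by omega))
  have hmem : ∀ d ∈ adm, tf (αOf d) (k : ℤ) ∈ windowSet κ σ X := by
    intro d hd
    have hd2 := hodd d hd
    rw [hadmdef, Finset.mem_filter, primesIoc, Finset.mem_filter, Finset.mem_Ioc] at hd
    obtain ⟨⟨⟨hAd, hdV⟩, hdp⟩, hdp', hdk⟩ := hd
    have hd0 : (0 : ℝ) < d := by exact_mod_cast hdp.pos
    set ℓd : ℝ := Real.log d with hℓddef
    have hdU : (d : ℝ) ≤ U := le_trans (by exact_mod_cast hdV) hVU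
    have hℓdU : ℓd ≤ ℓU := by rw [← hlogU]; exact Real.log_le_log hd0 hdU
    have hℓLd : ℓL < ℓd := by
      have hLd : L < d := lt_of_le_of_lt (Nat.le_ceil L) (by exact_mod_cast lt_of_le_of_lt hAL hAd)
      have := Real.log_lt_log hL0 hLd
      rwa [hLdef, Real.log_exp] at this
    have hlogN : Real.log ((d : ℝ) ^ 2 * (r₀ : ℝ)) = 2 * ℓd + ρ := by
      rw [Real.log_mul (by positivity) hr₀0.ne', Real.log_pow]; push_cast; ring
    have hlogM : Real.log ((d : ℝ) ^ 6 * ((mOf k : ℕ) : ℝ) ^ 3) = 6 * ℓd + 3 * Lm := by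
      rw [Real.log_mul (by positivity) (by positivity), Real.log_pow, Real.log_pow]; push_cast; ring
    refine tf_mem_window hp hj0 hq hk hdp (by omega) hdp' hdk (αOf_spec hd2) ?_ ?_ ?_
    · rw [hXdef, mul_comm]
      exact mul_le_mul_of_nonneg_left (pow_le_pow_left₀ hd0.le hdU 2) hr₀0.le
    · rw [hlogN, hlogM]
      have : (2 * κ - 6) * ℓd ≤ (2 * κ - 6) * ℓU := mul_le_mul_of_nonneg_left hℓdU h26.le
      linarith [hLm_lo, hℓU_mul, this]
    · rw [hlogN, hlogM]
      have : (2 * σ - 6) * ℓL ≤ (2 * σ - 6) * ℓd := mul_le_mul_of_nonneg_left hℓLd.le h2σ.le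
      linarith [hℓL_mul, this]
  have hinj : Set.InjOn (fun d => tf (αOf d) (k : ℤ)) ↑adm := fun d hd d' hd' h =>
    tf_αOf_injOn k (hodd d hd) (hodd d' hd') h
  have hcount : (adm.card : ℝ) ≤ (windowCount κ σ X : ℝ) := by
    exact_mod_cast card_le_windowCount_of_forall_mem adm _ hinj hmem
  ------------------------------------------------------------------
  -- the law at `X` and the contradiction
  ------------------------------------------------------------------
  have hlogX : Real.log X = ρ + 2 * ℓU := by
    rw [hXdef, Real.log_mul hr₀0.ne' (by positivity), Real.log_pow, hlogU]; push_cast; ring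
  have hXδ : X ^ δ = Real.exp (δ * ρ + 2 * δ * ℓU) := by
    rw [Real.rpow_def_of_pos hX0, hlogX]; ring_nf
  set R : ℝ := C * Real.exp (δ * ρ + 2 * δ * ℓU) with hRdef
  have hadmR : (adm.card : ℝ) ≤ R := by rw [hRdef, ← hXδ]; exact hcount.trans (hlaw X hX1)
  have hα' : (2 * j * P + 1) * ℓU ≤ U / 16 := by
    have h0 : (4 : ℝ) * 1 ≤ j * P := mul_le_mul hj4 hP1 (by norm_num) (by positivity)
    have h2 : (2 * j * P + 1) * ℓU ≤ 3 * j * P * (a' * P) :=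
      mul_le_mul (by linarith) hℓU_hi hℓU0.le (by positivity)
    linarith [hU_E3]
  have hβ' : R * ℓU < U / 16 := by
    have E1 : (2 * κ - 6) * ((1 - 2 * δ) * ℓU - δ * ρ) =
        (1 - 2 * δ) * (6 * j * P - Real.log 8) - (κ - 6 * δ) * ρ := by
      have : (2 * κ - 6) * ((1 - 2 * δ) * ℓU - δ * ρ) =
          (1 - 2 * δ) * ((2 * κ - 6) * ℓU) - (2 * κ - 6) * δ * ρ := by ring
      rw [this, hℓU_mul]; ring
    have E3 : (2 * κ - 6) * (γ * P - c₀) =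
        ((6 * j - κ * (j + 1)) * (1 - 2 * δ) - (j + 1) * δ * (2 * κ - 6)) * P - Real.log 8 := by
      have : (2 * κ - 6) * (γ * P - c₀) = ((2 * κ - 6) * γ) * P - (2 * κ - 6) * c₀ := by ring
      rw [this, hγ_mul, hc₀_mul]
    have E4 : (2 * κ - 6) * ((1 - 2 * δ) * ℓU - δ * ρ) - (2 * κ - 6) * (γ * P - c₀) =
        (κ - 6 * δ) * ((j + 1) * P - ρ) + 2 * δ * Real.log 8 := by rw [E1, E3]; ring
    have hpos : 0 ≤ (κ - 6 * δ) * ((j + 1) * P - ρ) + 2 * δ * Real.log 8 :=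
      add_nonneg (mul_nonneg h6δ.le (by linarith)) (by positivity)
    have hexp1 : γ * P - c₀ ≤ (1 - 2 * δ) * ℓU - δ * ρ := by
      have : (2 * κ - 6) * (γ * P - c₀) ≤ (2 * κ - 6) * ((1 - 2 * δ) * ℓU - δ * ρ) := by linarith
      exact le_of_mul_le_mul_left this h26
    have hpγ : Real.exp (γ * P) = (p : ℝ) ^ γ := by rw [Real.rpow_def_of_pos hp0, hPdef, mul_comm]
    have h1 : 32 * C * a' * P ≤ Real.exp (γ * P - c₀) := by
      rw [Real.exp_sub, hpγ, le_div_iff₀ hexpc₀]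
      have e : 32 * C * a' * P * Real.exp c₀ = 32 * C * a' * Real.exp c₀ * P := by ring
      rw [e]; exact hE4
    have h2 : 16 * C * ℓU < Real.exp ((1 - 2 * δ) * ℓU - δ * ρ) := by
      have h3 : 16 * C * ℓU ≤ 16 * C * (a' * P) := mul_le_mul_of_nonneg_left hℓU_hi (by linarith)
      have h4 : 0 < C * a' * P := mul_pos (mul_pos hC0 ha') (by linarith)
      have h5 := Real.exp_le_exp.mpr hexp1
      linarith
    have hUsplit : U = Real.exp ((1 - 2 * δ) * ℓU - δ * ρ) * Real.exp (δ * ρ + 2 * δ * ℓU) := by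
      rw [hUdef, ← Real.exp_add]; ring_nf
    have hE0 : 0 < Real.exp (δ * ρ + 2 * δ * ℓU) := Real.exp_pos _
    rw [hRdef, hUsplit, lt_div_iff₀ (by norm_num)]
    have h6 := mul_lt_mul_of_pos_right h2 hE0
    linarith
  have hfin : N₁ * ℓU ≤ (R + (2 * j * P + 1)) * ℓU := by
    apply mul_le_mul_of_nonneg_right _ hℓU0.le
    linarith [hcompl, hpf, hadmR]
  have hfin' : (R + (2 * j * P + 1)) * ℓU < U / 8 := by linarith
  linarith

end

end Summit.ABC.ABC.Theorems.ModerateWindowCount.Negative
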